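import Literature.Analysis.FluidPDE.LerayHopfTimeSliceTorus
import Literature.Analysis.FluidPDE.CheskidovAssemblyTools
import Mathlib.MeasureTheory.Function.LpSpace.ContinuousCompMeasurePreserving
import HarnessLib

/-!
# Galilean change of frame for Leray–Hopf solutions on the flat torus — continuity clauses

Analysis/FluidPDE support file (all proved).  Let `u` be a Leray–Hopf weak solution of the forced Navier–Stokes
equations on `T^d × [0, T)` (accepted `Torus.IsLerayHopfOn T ν F u₀ u`), `V ∈ ℝ^d` a constant velocity and
`a : ℝ → T^d` a continuous path of translations with `a 0 = 0` — for the Galilean boost `a t = proj (t • V)`, the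
class of `tV` on the torus.  The velocity seen from the moving frame is `ũ t y := u t (y + a t) - V`, with datum
`u₀ - V`.  This file proves the two continuity clauses of the Leray–Hopf definition (Galdi 2000, Def. 2.1 (iv) and
Lemma 2.2; fields `weak_continuous`, `strong_initial` of `Torus.IsLerayHopfOn`) for `ũ`:

* `IsLerayHopfOn.galilean_weak_continuous` — for every `w ∈ L²`, `t ↦ ∫⟪ũ t, w⟫` is continuous on `(0, T]` and
  tends to `∫⟪u₀ - V, w⟫` as `t → 0⁺`;
* `IsLerayHopfOn.galilean_strong_initial` — `‖ũ t - (u₀ - V)‖_{L²} → 0` as `t → 0⁺`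

(general continuous paths `a`: `IsLerayHopfOn.weak_continuous_comp_add_path`,
`IsLerayHopfOn.strong_initial_comp_add_path`).  Ingredients of independent use:

* `tendsto_eLpNorm_translate_sub` — **translation is continuous in `L²(T^d)`**: `‖w(· - b) - w(· - b₀)‖₂ → 0`
  as `b → b₀` (Mathlib's `MeasureTheory.Lp.compMeasurePreserving_continuous`, applied to the continuous family of
  Haar-measure preserving translations of the compact group `T^d`), with its squared (`∫⁻`, `∫`) forms;
* `IsLerayHopfOn.exists_forall_mem_Ioc_integral_norm_sq_le` — the `L^∞(0,T; L²)` bound of a Leray–Hopf solution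
  holds at EVERY time of `(0, T]`, not only almost everywhere: the good times are dense and `‖·‖₂` is weakly lower
  semicontinuous along the weakly continuous `t ↦ u t` (Galdi 2000, Lemma 2.2).  Neither a sign of `ν` nor a
  hypothesis on the force is needed;
* `IsLerayHopfOn.tendsto_integral_inner_translate_sub` — `∫⟪u t, w(· - b t) - w(· - b s)⟫ → 0` as `t → s`
  (Cauchy–Schwarz with the uniform bound and the continuity of translation).

The change of variables `y ↦ y + a t` (Haar invariance of the integral) turns `∫⟪ũ t, w⟫` into
`∫⟪u t, w(· - a t)⟫ - ∫⟪V, w⟫`, whence the weak clause; for the strong clause,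
`‖ũ t - (u₀ - V)‖₂² ≤ 2‖u t - u₀‖₂² + 2‖u₀(· + a t) - u₀‖₂²`, written with lower Lebesgue integrals so that no
measurability of the slices `u t` at times outside `[0, T]` is needed.

Standard: U. Frisch, *Turbulence* (1995), §2.2 (Galilean invariance of Navier–Stokes on the periodic box);
G. P. Galdi, *An introduction to the Navier–Stokes initial-boundary value problem* (2000), Def. 2.1, Lemma 2.2.
The weak formulation and the energy clauses of the boosted field are elsewhere (`LerayHopfGalileanTorus*`).

## Mathlib search

`MeasureTheory.Lp.compMeasurePreserving_continuous`, `Filter.Tendsto.compMeasurePreservingLp` (continuity of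
`g ∘ φ` in `L^p`, `p < ∞`, jointly in `g` and the measure-preserving continuous `φ`); `MeasureTheory.Measure.dense_of_ae`;
`measurePreserving_sub_right`, `MeasureTheory.integral_add_right_eq_self`, `MeasureTheory.lintegral_add_right_eq_self`
(Haar invariance on `UnitAddTorus d`).  No Navier–Stokes content in Mathlib.
-/

noncomputable section

open MeasureTheory Set Filter Topology
open scoped InnerProductSpace RealInnerProductSpace ENNReal NNReal

namespace Literature.Analysis.FluidPDE.Torus

open Literature.Analysis.FunctionSpaces Literature.Analysis.FunctionSpaces.Torus UnitAddTorus

variable {d : Type*} [Fintype d] [DecidableEq d]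

/-! ### Continuity of translation in `L²(T^d)` -/

omit [DecidableEq d] in
/-- **Translation is continuous in `L²(T^d)`**: for `w ∈ L²(T^d; ℝ^d)` and `b i → b₀`,
`‖w(· - b i) - w(· - b₀)‖_{L²} → 0` (continuity of `Lp.compMeasurePreserving` in the measure-preserving map, for
the continuous family `x ↦ x - c` of Haar translations of the compact group `T^d`). [folklore] -/
theorem tendsto_eLpNorm_translate_sub {w : UnitAddTorus d → EuclideanSpace ℝ d} (hw : MemLp w 2 volume)
    {ι : Type*} {l : Filter ι} {b : ι → UnitAddTorus d} {b₀ : UnitAddTorus d} (hb : Tendsto b l (𝓝 b₀)) :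
    Tendsto (fun i => eLpNorm (fun x => w (x - b i) - w (x - b₀)) 2 volume) l (𝓝 0) := by
  -- the translations, as a continuous family of continuous Haar-measure preserving maps of `T^d`
  set τ : UnitAddTorus d → C(UnitAddTorus d, UnitAddTorus d) :=
    fun c => ⟨fun x => x - c, continuous_id.sub continuous_const⟩
  have hτc : Continuous τ :=
    ContinuousMap.continuous_of_continuous_uncurry _ (continuous_snd.sub continuous_fst)
  have hmp : ∀ c, MeasurePreserving (τ c) volume volume := fun c => measurePreserving_sub_right volume c
  set W : Lp (EuclideanSpace ℝ d) 2 volume := hw.toLp w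
  have hLp : Tendsto (fun i => Lp.compMeasurePreserving (τ (b i)) (hmp (b i)) W) l
      (𝓝 (Lp.compMeasurePreserving (τ b₀) (hmp b₀) W)) :=
    (tendsto_const_nhds (x := W)).compMeasurePreservingLp ((hτc.tendsto b₀).comp hb) (fun i => hmp (b i))
      (hmp b₀) ENNReal.ofNat_ne_top
  rw [Lp.tendsto_Lp_iff_tendsto_eLpNorm'] at hLp
  have hae : ∀ c, ⇑(Lp.compMeasurePreserving (τ c) (hmp c) W) =ᵐ[volume] fun x => w (x - c) := fun c =>
    (Lp.coeFn_compMeasurePreserving W (hmp c)).trans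
      ((hmp c).quasiMeasurePreserving.ae_eq_comp hw.coeFn_toLp)
  refine hLp.congr fun i => eLpNorm_congr_ae ?_
  exact (hae (b i)).sub (hae b₀)

omit [DecidableEq d] in
/-- Continuity of translation in `L²(T^d)`, squared form with lower Lebesgue integrals:
`∫⁻ ‖w(· - b i) - w(· - b₀)‖ₑ² → 0` as `b i → b₀`. [folklore] -/
theorem tendsto_lintegral_enorm_sq_translate_sub {w : UnitAddTorus d → EuclideanSpace ℝ d}
    (hw : MemLp w 2 volume) {ι : Type*} {l : Filter ι} {b : ι → UnitAddTorus d} {b₀ : UnitAddTorus d}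
    (hb : Tendsto b l (𝓝 b₀)) :
    Tendsto (fun i => ∫⁻ x, ‖w (x - b i) - w (x - b₀)‖ₑ ^ 2) l (𝓝 0) := by
  have h := ((ENNReal.continuous_rpow_const (y := 2)).tendsto 0).comp
    (tendsto_eLpNorm_translate_sub hw hb)
  rw [ENNReal.zero_rpow_of_pos two_pos] at h
  refine h.congr fun i => ?_
  rw [Function.comp_apply, eLpNorm_two_eq_rpow, ← ENNReal.rpow_mul]
  norm_num

omit [DecidableEq d] in
/-- Continuity of translation in `L²(T^d)`, squared Bochner form: `∫ ‖w(· - b i) - w(· - b₀)‖² → 0` as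
`b i → b₀`. [folklore] -/
theorem tendsto_integral_norm_sq_translate_sub {w : UnitAddTorus d → EuclideanSpace ℝ d}
    (hw : MemLp w 2 volume) {ι : Type*} {l : Filter ι} {b : ι → UnitAddTorus d} {b₀ : UnitAddTorus d}
    (hb : Tendsto b l (𝓝 b₀)) :
    Tendsto (fun i => ∫ x, ‖w (x - b i) - w (x - b₀)‖ ^ 2) l (𝓝 0) := by
  have hG : ∀ i, MemLp (fun x => w (x - b i) - w (x - b₀)) 2 volume := fun i =>
    (hw.comp_measurePreserving (measurePreserving_sub_right volume (b i))).sub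
      (hw.comp_measurePreserving (measurePreserving_sub_right volume b₀))
  have h0 : Tendsto (fun i => eLpNorm ((fun x => w (x - b i) - w (x - b₀)) - 0) 2 volume) l (𝓝 0) := by
    simpa only [sub_zero] using tendsto_eLpNorm_translate_sub hw hb
  have h := tendsto_integral_norm_sq_of_tendsto_eLpNorm_sub (v := fun i x => w (x - b i) - w (x - b₀))
    (w := 0) hG MemLp.zero h0
  simpa only [Pi.zero_apply, norm_zero, ne_eq, OfNat.ofNat_ne_zero, not_false_eq_true, zero_pow,
    integral_zero] using h

/-! ### The `L^∞(0,T; L²)` bound holds at every time of `(0, T]` -/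

variable {T ν : ℝ} {F : ℝ → UnitAddTorus d → EuclideanSpace ℝ d} {u₀ : UnitAddTorus d → EuclideanSpace ℝ d}
  {u : ℝ → UnitAddTorus d → EuclideanSpace ℝ d}

/-- **Every slice of a Leray–Hopf solution obeys the `L^∞(0,T;L²)` bound** (Galdi 2000, Lemma 2.2): there is
`C` with `∫ ‖u t‖² ≤ C` for EVERY `t ∈ (0, T]`.  The clause `energy_bound` gives it for a.e. `t ∈ (0, T)`; such
times are dense in `[0, T]` (`Measure.dense_of_ae`), and testing the weak `L²` continuity of `s ↦ u s` at `t`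
against `w := u t` gives `∫ ‖u t‖² = lim ∫⟪u s, u t⟫ ≤ √C · √(∫‖u t‖²)` along good times `s → t`
(Cauchy–Schwarz), i.e. the weak lower semicontinuity of the norm.  No sign condition on `ν` and no hypothesis on
the force enter. [folklore] -/
theorem IsLerayHopfOn.exists_forall_mem_Ioc_integral_norm_sq_le (h : IsLerayHopfOn T ν F u₀ u) (hT : 0 < T) :
    ∃ C : ℝ, 0 ≤ C ∧ ∀ t ∈ Ioc 0 T, ∫ x, ‖u t x‖ ^ 2 ≤ C := by
  obtain ⟨C, hC0, hC⟩ := h.exists_integral_norm_sq_le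
  refine ⟨C, hC0, fun t ht => ?_⟩
  -- the good times, and `t` is in their closure
  set S : Set ℝ := {s | s ∈ Ioo 0 T ∧ ∫ x, ‖u s x‖ ^ 2 ≤ C}
  have hdense : Dense {s : ℝ | s ∈ Ioo 0 T → ∫ x, ‖u s x‖ ^ 2 ≤ C} :=
    Measure.dense_of_ae ((ae_restrict_iff' measurableSet_Ioo).1 hC)
  have hclos : t ∈ closure S := by
    have h1 : Ioo 0 T ⊆ closure S := by
      refine (hdense.open_subset_closure_inter isOpen_Ioo).trans (closure_mono ?_)
      rintro s ⟨hsI, hs⟩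
      exact ⟨hsI, hs hsI⟩
    have h2 : closure (Ioo 0 T) ⊆ closure S := closure_minimal h1 isClosed_closure
    exact h2 (by rw [closure_Ioo hT.ne]; exact ⟨ht.1.le, ht.2⟩)
  haveI : (𝓝[S] t).NeBot := mem_closure_iff_nhdsWithin_neBot.1 hclos
  -- test the weak continuity at `t` against `u t`
  have hU : MemLp (u t) 2 volume := h.memLp t ⟨ht.1.le, ht.2⟩
  have hcont : Tendsto (fun s => ∫ x, ⟪u s x, u t x⟫) (𝓝[S] t) (𝓝 (∫ x, ⟪u t x, u t x⟫)) :=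
    ((h.weak_continuous (u t) hU).1 t ht).tendsto.mono_left
      (nhdsWithin_mono t fun s hs => ⟨hs.1.1, hs.1.2.le⟩)
  have hbound : ∀ᶠ s in 𝓝[S] t, ∫ x, ⟪u s x, u t x⟫ ≤ Real.sqrt C * Real.sqrt (∫ x, ‖u t x‖ ^ 2) := by
    filter_upwards [self_mem_nhdsWithin] with s hs
    have hs2 : MemLp (u s) 2 volume := h.memLp s (Ioo_subset_Icc_self hs.1)
    refine (le_abs_self _).trans ((abs_integral_inner_le_sqrt_mul_sqrt hs2 hU).trans ?_)
    exact mul_le_mul_of_nonneg_right (Real.sqrt_le_sqrt hs.2) (Real.sqrt_nonneg _)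
  have hle : ∫ x, ⟪u t x, u t x⟫ ≤ Real.sqrt C * Real.sqrt (∫ x, ‖u t x‖ ^ 2) :=
    le_of_tendsto hcont hbound
  have heq : ∫ x, ⟪u t x, u t x⟫ = ∫ x, ‖u t x‖ ^ 2 :=
    integral_congr_ae (ae_of_all _ fun x => real_inner_self_eq_norm_sq (u t x))
  rw [heq] at hle
  -- `x ≤ √C √x` forces `x ≤ C`
  have hx0 : 0 ≤ ∫ x, ‖u t x‖ ^ 2 := integral_nonneg fun _ => sq_nonneg _
  refine le_of_not_gt fun hlt => ?_
  have hxpos : 0 < ∫ x, ‖u t x‖ ^ 2 := hC0.trans_lt hlt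
  have h1 : Real.sqrt C < Real.sqrt (∫ x, ‖u t x‖ ^ 2) := Real.sqrt_lt_sqrt hC0 hlt
  have h2 : Real.sqrt C * Real.sqrt (∫ x, ‖u t x‖ ^ 2) <
      Real.sqrt (∫ x, ‖u t x‖ ^ 2) * Real.sqrt (∫ x, ‖u t x‖ ^ 2) :=
    mul_lt_mul_of_pos_right h1 (Real.sqrt_pos.2 hxpos)
  rw [Real.mul_self_sqrt hx0] at h2
  exact absurd (hle.trans_lt h2) (lt_irrefl _)

/-! ### Pairings with a moving test field -/

/-- **Pairings of a Leray–Hopf solution with a moving translate of a test field**: for `w ∈ L²`, a continuous path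
`b : ℝ → T^d`, and a filter `l → s` along which eventually `t ∈ (0, T]`,
`∫⟪u t, w(· - b t) - w(· - b s)⟫ → 0` (Cauchy–Schwarz: `≤ ‖u t‖₂ ‖w(· - b t) - w(· - b s)‖₂`, with `‖u t‖₂` bounded
on `(0, T]` and translation continuous in `L²`). [folklore] -/
theorem IsLerayHopfOn.tendsto_integral_inner_translate_sub (h : IsLerayHopfOn T ν F u₀ u) (hT : 0 < T)
    {w : UnitAddTorus d → EuclideanSpace ℝ d} (hw : MemLp w 2 volume) {b : ℝ → UnitAddTorus d}
    (hb : Continuous b) {s : ℝ} {l : Filter ℝ} (hl : l ≤ 𝓝 s) (hl' : ∀ᶠ t in l, t ∈ Ioc 0 T) :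
    Tendsto (fun t => ∫ x, ⟪u t x, w (x - b t) - w (x - b s)⟫) l (𝓝 0) := by
  obtain ⟨M, -, hM⟩ := h.exists_forall_mem_Ioc_integral_norm_sq_le hT
  have hG : ∀ t, MemLp (fun x => w (x - b t) - w (x - b s)) 2 volume := fun t =>
    (hw.comp_measurePreserving (measurePreserving_sub_right volume (b t))).sub
      (hw.comp_measurePreserving (measurePreserving_sub_right volume (b s)))
  have h2 : Tendsto (fun t => ∫ x, ‖w (x - b t) - w (x - b s)‖ ^ 2) l (𝓝 0) :=
    tendsto_integral_norm_sq_translate_sub hw ((hb.tendsto s).mono_left hl)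
  have hbd : ∀ᶠ t in l, ‖∫ x, ⟪u t x, w (x - b t) - w (x - b s)⟫‖ ≤
      Real.sqrt M * Real.sqrt (∫ x, ‖w (x - b t) - w (x - b s)‖ ^ 2) := by
    filter_upwards [hl'] with t ht
    rw [Real.norm_eq_abs]
    refine (abs_integral_inner_le_sqrt_mul_sqrt (h.memLp t ⟨ht.1.le, ht.2⟩) (hG t)).trans ?_
    exact mul_le_mul_of_nonneg_right (Real.sqrt_le_sqrt (hM t ht)) (Real.sqrt_nonneg _)
  refine squeeze_zero_norm' hbd ?_
  have h3 := ((Real.continuous_sqrt.tendsto 0).comp h2).const_mul (Real.sqrt M)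
  simpa only [Function.comp_def, Real.sqrt_zero, mul_zero] using h3

/-! ### The moving frame: weak continuity and the strong trace -/

omit [DecidableEq d] in
/-- Change of variables in the pairing of a frame-shifted slice: for `v, w ∈ L²`, `a ∈ T^d`, `V ∈ ℝ^d`,
`∫⟪v(· + a) - V, w⟫ = ∫⟪v, w(· - a)⟫ - ∫⟪V, w⟫` (Haar invariance `∫ g(· + a) = ∫ g`). [folklore] -/
theorem integral_inner_comp_add_right_sub_const_eq_sub {v w : UnitAddTorus d → EuclideanSpace ℝ d}
    (hv : MemLp v 2 volume) (hw : MemLp w 2 volume) (a : UnitAddTorus d) (V : EuclideanSpace ℝ d) :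
    ∫ y, ⟪v (y + a) - V, w y⟫ = (∫ x, ⟪v x, w (x - a)⟫) - ∫ y, ⟪V, w y⟫ := by
  have i1 : Integrable (fun y => ⟪v (y + a), w y⟫) volume :=
    integrable_inner_of_memLp (hv.comp_measurePreserving (measurePreserving_add_right volume a)) hw
  have i2 : Integrable (fun y => ⟪V, w y⟫) volume := (hw.integrable one_le_two).const_inner V
  have e1 : ∫ y, ⟪v (y + a), w y⟫ = ∫ x, ⟪v x, w (x - a)⟫ := by
    have : (fun y => ⟪v (y + a), w y⟫) = fun y => (fun x => ⟪v x, w (x - a)⟫) (y + a) := by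
      funext y
      simp only [add_sub_cancel_right]
    rw [this]
    exact integral_add_right_eq_self (fun x => ⟪v x, w (x - a)⟫) a
  simp_rw [inner_sub_left]
  rw [integral_sub i1 i2, e1]

/-- **Weak `L²` continuity in a moving frame.** For a Leray–Hopf solution `u` on `T^d × [0,T)`, `T > 0`, a
continuous path `a : ℝ → T^d` with `a 0 = 0`, a constant `V` and a datum `u₀ ∈ L²`: for every `w ∈ L²` the pairing
`t ↦ ∫⟪u t (· + a t) - V, w⟫` is continuous on `(0, T]` and tends to `∫⟪u₀ - V, w⟫` as `t → 0⁺`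
(`= ∫⟪u t, w(· - a t)⟫ - ∫⟪V, w⟫`; the weak continuity of `u` against the fixed field `w(· - a s)` and
`tendsto_integral_inner_translate_sub`; Galdi 2000, Lemma 2.2). [folklore] -/
theorem IsLerayHopfOn.weak_continuous_comp_add_path (h : IsLerayHopfOn T ν F u₀ u) (hT : 0 < T)
    (hu₀ : MemLp u₀ 2 volume) {a : ℝ → UnitAddTorus d} (ha : Continuous a) (ha0 : a 0 = 0)
    (V : EuclideanSpace ℝ d) (w : UnitAddTorus d → EuclideanSpace ℝ d) (hw : MemLp w 2 volume) :
    ContinuousOn (fun t => ∫ y, ⟪u t (y + a t) - V, w y⟫) (Ioc 0 T) ∧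
      Tendsto (fun t => ∫ y, ⟪u t (y + a t) - V, w y⟫) (𝓝[>] 0) (𝓝 (∫ y, ⟪u₀ y - V, w y⟫)) := by
  -- the pairing in the fixed frame, on `(0, T]`
  have hP : ∀ t ∈ Ioc 0 T,
      ∫ y, ⟪u t (y + a t) - V, w y⟫ = (∫ x, ⟪u t x, w (x - a t)⟫) - ∫ y, ⟪V, w y⟫ :=
    fun t ht => integral_inner_comp_add_right_sub_const_eq_sub (h.memLp t ⟨ht.1.le, ht.2⟩) hw (a t) V
  -- splitting off the moving part of the test field
  have hws : ∀ s, MemLp (fun x => w (x - a s)) 2 volume := fun s =>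
    hw.comp_measurePreserving (measurePreserving_sub_right volume (a s))
  have hQ : ∀ s, ∀ t ∈ Ioc 0 T, ∫ x, ⟪u t x, w (x - a t)⟫ =
      (∫ x, ⟪u t x, w (x - a s)⟫) + ∫ x, ⟪u t x, w (x - a t) - w (x - a s)⟫ := by
    intro s t ht
    have hut : MemLp (u t) 2 volume := h.memLp t ⟨ht.1.le, ht.2⟩
    have hG : MemLp (fun x => w (x - a t) - w (x - a s)) 2 volume := (hws t).sub (hws s)
    calc ∫ x, ⟪u t x, w (x - a t)⟫
        = ∫ x, (⟪u t x, w (x - a s)⟫ + ⟪u t x, w (x - a t) - w (x - a s)⟫) :=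
          integral_congr_ae (ae_of_all _ fun x => by
            dsimp only
            rw [← inner_add_right, add_sub_cancel])
      _ = (∫ x, ⟪u t x, w (x - a s)⟫) + ∫ x, ⟪u t x, w (x - a t) - w (x - a s)⟫ :=
          integral_add (integrable_inner_of_memLp hut (hws s)) (integrable_inner_of_memLp hut hG)
  refine ⟨fun s hs => ?_, ?_⟩
  · -- continuity within `(0, T]` at `s`
    have h1 : Tendsto (fun t => ∫ x, ⟪u t x, w (x - a s)⟫) (𝓝[Ioc 0 T] s)
        (𝓝 (∫ x, ⟪u s x, w (x - a s)⟫)) :=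
      ((h.weak_continuous _ (hws s)).1 s hs).tendsto
    have h2 : Tendsto (fun t => ∫ x, ⟪u t x, w (x - a t) - w (x - a s)⟫) (𝓝[Ioc 0 T] s) (𝓝 0) :=
      h.tendsto_integral_inner_translate_sub hT hw ha nhdsWithin_le_nhds self_mem_nhdsWithin
    have h3 := (h1.add h2).sub_const (∫ y, ⟪V, w y⟫)
    rw [add_zero] at h3
    have hev : ∀ᶠ t in 𝓝[Ioc 0 T] s,
        (∫ x, ⟪u t x, w (x - a s)⟫) + (∫ x, ⟪u t x, w (x - a t) - w (x - a s)⟫) - ∫ y, ⟪V, w y⟫ =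
          ∫ y, ⟪u t (y + a t) - V, w y⟫ := by
      filter_upwards [self_mem_nhdsWithin] with t ht
      rw [hP t ht, hQ s t ht]
    have hval : (∫ x, ⟪u s x, w (x - a s)⟫) - ∫ y, ⟪V, w y⟫ = ∫ y, ⟪u s (y + a s) - V, w y⟫ := by
      rw [hP s hs]
    rw [hval] at h3
    exact h3.congr' hev
  · -- the limit at `0⁺`
    have hIoc : ∀ᶠ t in 𝓝[>] (0 : ℝ), t ∈ Ioc 0 T := Ioc_mem_nhdsGT hT
    have h1 : Tendsto (fun t => ∫ x, ⟪u t x, w (x - a 0)⟫) (𝓝[>] 0) (𝓝 (∫ x, ⟪u₀ x, w (x - a 0)⟫)) :=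
      (h.weak_continuous _ (hws 0)).2
    have h2 : Tendsto (fun t => ∫ x, ⟪u t x, w (x - a t) - w (x - a 0)⟫) (𝓝[>] 0) (𝓝 0) :=
      h.tendsto_integral_inner_translate_sub hT hw ha nhdsWithin_le_nhds hIoc
    have h3 := (h1.add h2).sub_const (∫ y, ⟪V, w y⟫)
    rw [add_zero] at h3
    have hev : ∀ᶠ t in 𝓝[>] (0 : ℝ),
        (∫ x, ⟪u t x, w (x - a 0)⟫) + (∫ x, ⟪u t x, w (x - a t) - w (x - a 0)⟫) - ∫ y, ⟪V, w y⟫ =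
          ∫ y, ⟪u t (y + a t) - V, w y⟫ := by
      filter_upwards [hIoc] with t ht
      rw [hP t ht, hQ 0 t ht]
    have hval : (∫ x, ⟪u₀ x, w (x - a 0)⟫) - ∫ y, ⟪V, w y⟫ = ∫ y, ⟪u₀ y - V, w y⟫ := by
      have e := integral_inner_comp_add_right_sub_const_eq_sub hu₀ hw (a 0) V
      rw [← e, ha0]
      simp only [add_zero]
    rw [hval] at h3
    exact h3.congr' hev

/-- **The strong `L²` trace in a moving frame.** For a Leray–Hopf solution `u` on `T^d × [0,T)` with datum
`u₀ ∈ L²`, a continuous path `a : ℝ → T^d` with `a 0 = 0` and a constant `V`: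
`‖(u t (· + a t) - V) - (u₀ - V)‖_{L²} → 0` as `t → 0⁺`, from
`‖u t (· + a t) - u₀‖₂² ≤ 2‖u t - u₀‖₂² + 2‖u₀(· + a t) - u₀‖₂²` (Haar invariance of `∫⁻`), the strong trace of `u`
and the continuity of translation in `L²` (Galdi 2000, Def. 2.1 (iv)). [folklore] -/
theorem IsLerayHopfOn.strong_initial_comp_add_path (h : IsLerayHopfOn T ν F u₀ u) (hu₀ : MemLp u₀ 2 volume)
    {a : ℝ → UnitAddTorus d} (ha : Continuous a) (ha0 : a 0 = 0) (V : EuclideanSpace ℝ d) :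
    Tendsto (fun t => eLpNorm ((fun y => u t (y + a t) - V) - fun y => u₀ y - V) 2 volume)
      (𝓝[>] 0) (𝓝 0) := by
  -- `D t = ∫⁻ ‖u t - u₀‖ₑ² → 0` (strong trace of `u`)
  have hD : Tendsto (fun t => ∫⁻ y, ‖u t y - u₀ y‖ₑ ^ 2) (𝓝[>] 0) (𝓝 0) := by
    have h1 := ((ENNReal.continuous_rpow_const (y := 2)).tendsto 0).comp h.strong_initial
    rw [ENNReal.zero_rpow_of_pos two_pos] at h1
    refine h1.congr fun t => ?_
    rw [Function.comp_apply, eLpNorm_two_eq_rpow, ← ENNReal.rpow_mul]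
    norm_num
  -- `E t = ∫⁻ ‖u₀(· + a t) - u₀‖ₑ² → 0` (continuity of translation)
  have hE : Tendsto (fun t => ∫⁻ y, ‖u₀ (y + a t) - u₀ y‖ₑ ^ 2) (𝓝[>] 0) (𝓝 0) := by
    have h1 := tendsto_lintegral_enorm_sq_translate_sub hu₀ (b := fun t => -a t) (b₀ := -a 0)
      ((ha.neg.tendsto 0).mono_left (nhdsWithin_le_nhds (s := Ioi (0 : ℝ))))
    simpa only [sub_neg_eq_add, ha0, neg_zero, sub_zero] using h1
  -- the pointwise parallelogram bound, integrated (Haar invariance for the first term)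
  have hle : ∀ t, ∫⁻ y, ‖u t (y + a t) - u₀ y‖ₑ ^ 2 ≤
      2 * (∫⁻ y, ‖u t y - u₀ y‖ₑ ^ 2) + 2 * ∫⁻ y, ‖u₀ (y + a t) - u₀ y‖ₑ ^ 2 := by
    intro t
    have hm : AEMeasurable (fun y => 2 * ‖u₀ (y + a t) - u₀ y‖ₑ ^ 2) volume :=
      (((hu₀.aestronglyMeasurable.comp_measurePreserving (measurePreserving_add_right volume (a t))).sub
        hu₀.aestronglyMeasurable).enorm.pow_const 2).const_mul 2
    calc ∫⁻ y, ‖u t (y + a t) - u₀ y‖ₑ ^ 2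
        ≤ ∫⁻ y, (2 * ‖u t (y + a t) - u₀ (y + a t)‖ₑ ^ 2 + 2 * ‖u₀ (y + a t) - u₀ y‖ₑ ^ 2) := by
          refine lintegral_mono fun y => ?_
          have := enorm_sq_le_two_mul_add (u t (y + a t) - u₀ y) (u₀ (y + a t) - u₀ y)
          rwa [sub_sub_sub_cancel_right] at this
      _ = 2 * (∫⁻ y, ‖u t (y + a t) - u₀ (y + a t)‖ₑ ^ 2) + 2 * ∫⁻ y, ‖u₀ (y + a t) - u₀ y‖ₑ ^ 2 := by
          rw [lintegral_add_right' _ hm, lintegral_const_mul' _ _ ENNReal.ofNat_ne_top,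
            lintegral_const_mul' _ _ ENNReal.ofNat_ne_top]
      _ = 2 * (∫⁻ y, ‖u t y - u₀ y‖ₑ ^ 2) + 2 * ∫⁻ y, ‖u₀ (y + a t) - u₀ y‖ₑ ^ 2 := by
          rw [lintegral_add_right_eq_self (fun y => ‖u t y - u₀ y‖ₑ ^ 2) (a t)]
  -- squeeze
  have hlim : Tendsto (fun t => ∫⁻ y, ‖u t (y + a t) - u₀ y‖ₑ ^ 2) (𝓝[>] 0) (𝓝 0) := by
    have hs := (ENNReal.Tendsto.const_mul (a := 2) hD (Or.inr ENNReal.ofNat_ne_top)).add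
      (ENNReal.Tendsto.const_mul (a := 2) hE (Or.inr ENNReal.ofNat_ne_top))
    rw [mul_zero, add_zero] at hs
    exact tendsto_of_tendsto_of_tendsto_of_le_of_le tendsto_const_nhds hs (fun t => zero_le) hle
  -- back to `eLpNorm`
  have h1 := ((ENNReal.continuous_rpow_const (y := 1 / 2)).tendsto 0).comp hlim
  rw [ENNReal.zero_rpow_of_pos (by norm_num)] at h1
  refine h1.congr fun t => ?_
  rw [Function.comp_apply, ← eLpNorm_two_eq_rpow]
  congr 1
  funext y
  simp only [Pi.sub_apply, sub_sub_sub_cancel_right]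

/-! ### The Galilean boost `a t = proj (t • V)` (continuous, `a 0 = 0`) -/

variable {f : UnitAddTorus d → EuclideanSpace ℝ d}

/-- **Weak `L²` continuity of the Galilean boost of a Leray–Hopf solution** (field `weak_continuous` of
`Torus.IsLerayHopfOn` for the boosted velocity `(t, y) ↦ u t (y + proj (t • V)) - V` and datum `u₀ - V`): for every
`w ∈ L²`, `t ↦ ∫⟪u t (· + [tV]) - V, w⟫` is continuous on `(0, T]` and tends to `∫⟪u₀ - V, w⟫` as `t → 0⁺`
(U. Frisch, *Turbulence* (1995), §2.2; G. P. Galdi (2000), Def. 2.1 and Lemma 2.2). [folklore] -/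
theorem IsLerayHopfOn.galilean_weak_continuous (h : IsLerayHopfOn T ν (fun _ => f) u₀ u) (hT : 0 < T)
    (hu₀ : MemLp u₀ 2 volume) (V : EuclideanSpace ℝ d) :
    ∀ w : UnitAddTorus d → EuclideanSpace ℝ d, MemLp w 2 volume →
      ContinuousOn (fun t => ∫ y, ⟪u t (y + FunctionSpaces.Torus.proj (t • V)) - V, w y⟫) (Ioc 0 T) ∧
        Tendsto (fun t => ∫ y, ⟪u t (y + FunctionSpaces.Torus.proj (t • V)) - V, w y⟫) (𝓝[>] 0)
          (𝓝 (∫ y, ⟪u₀ y - V, w y⟫)) :=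
  fun w hw => h.weak_continuous_comp_add_path (a := fun t => proj (t • V)) hT hu₀
    (continuous_proj.comp (continuous_id.smul continuous_const))
    (show proj ((0 : ℝ) • V) = 0 by rw [zero_smul, proj_zero]) V w hw

/-- **Strong `L²` trace of the Galilean boost of a Leray–Hopf solution** (field `strong_initial` of
`Torus.IsLerayHopfOn` for the boosted velocity and the datum `u₀ - V`):
`‖(u t (· + [tV]) - V) - (u₀ - V)‖_{L²} → 0` as `t → 0⁺` (U. Frisch, *Turbulence* (1995), §2.2; G. P. Galdi (2000),
Def. 2.1 (iv)). [folklore] -/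
theorem IsLerayHopfOn.galilean_strong_initial (h : IsLerayHopfOn T ν (fun _ => f) u₀ u)
    (hu₀ : MemLp u₀ 2 volume) (V : EuclideanSpace ℝ d) :
    Tendsto (fun t =>
      eLpNorm ((fun y => u t (y + FunctionSpaces.Torus.proj (t • V)) - V) - fun y => u₀ y - V) 2 volume)
      (𝓝[>] 0) (𝓝 0) :=
  h.strong_initial_comp_add_path (a := fun t => proj (t • V)) hu₀
    (continuous_proj.comp (continuous_id.smul continuous_const))
    (show proj ((0 : ℝ) • V) = 0 by rw [zero_smul, proj_zero]) V

end Literature.Analysis.FluidPDE.Torus
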